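import Summits.QuantumAdvantage.AdviceFreeQNC0.RingHardOdd
import Summits.QuantumAdvantage.AdviceFreeQNC0.WalkCharacters
import HarnessLib

/-!
# Cell qa-qnc0 (p = 3, next rung after (NP₁)): the SPARSE-COUPLING rung `RingHardSparse3` — STATEMENTS + the finite
resonance lemma (planner qa-qnc0-p2 g34, ROUND-34P2 §4.4)

The (NP₁) engine (HOME qa-qnc0-p2/line34/AffBells37.lean: pair slicing + 𝔽₄ Kraft + sparsity + resonance + Markov)
never uses «degree 1»; it uses that ON A PAIR SLICE every output is an indicator of an AFFINE function of the free bits.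
For a polynomial strategy `P : Fin n → CubeFn (ZMod 3) n` written on monomial supports `𝓢`, that holds as soon as no
monomial contains free variables of two different windows (H1), and the resonance step survives — FOR EVERY DEGREE —
as soon as every gap between consecutive windows contains an INSULATOR: a position coupled to no free variable (H2):
the involutions «complement the walk bits on [insulator, window)» flip exactly one free sign each, fix every coefficient,
and generate a free `(ℤ/2)^{2F}` action, so `E_a 2^{#zero letters} ≤ (3/2)^F` by the 4-pattern lemma
`fourPattern_le_two` below (checked by `decide`).  Hence:

* `InsulatedWindows 𝓢 F` — (H1)+(H2)+(H3) for `F` windows;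
* **`RingHardSparse3`** — every strategy whose monomial supports admit `C·log₂ n` insulated windows solves the ring
  relation on at most `(1 − n^{−e})·2^{n−1}` odd patterns (NO degree hypothesis);
* `RingHardFewCouplings3` — corollary shape: at most `n² / (C·(log₂ n)^3)` coupled position-pairs suffice;
* `fourPattern_le_two` — the finite resonance lemma (PROVED, `decide`).

WHAT THIS IS NOT: `RingHardSparse3` / `RingHardFewCouplings3` are OPEN here (paper proof ROUND-34P2 §4.4; the Lean
proof is the (NP₁) files with (E) generalised by `Submodule.span_induction` and (R) replaced by the involution count);
they do NOT reach `RingHardOdd 3` (dense coupling — every pair of positions in a common monomial — is exactly the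
residual core, where the symmetric quadratic obstruction lives); crux 22907 untouched; separation NOT moved.
-/

namespace Summit.QuantumAdvantage.AdviceFreeQNC0.NPGamma37

open Finset Literature.Computability.QuantumComplexity Literature.Computability.MetaComplexity

/-! ### Statements -/

/-- Positions `i, i'` (as naturals) are COUPLED by the support family `𝓢`: some monomial support contains both. -/
def NCoupled {n : ℕ} (𝓢 : Set (Finset (Fin n))) (i i' : ℕ) : Prop :=
  ∃ S ∈ 𝓢, ∃ a ∈ S, ∃ b ∈ S, (a : ℕ) = i ∧ (b : ℕ) = i'

/-- An INSULATED WINDOW SYSTEM of size `F` for `𝓢` on the ring of length `n`: free pairs `{p j, p j + 1}` (`j < F`)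
and insulators `q i` (`i ≤ F`) interleaved `2 ≤ q 0 < p 0 < p 0 + 1 < q 1 < p 1 < … < p (F-1) + 1 < q F ≤ n − 3`, with
(H1) no monomial coupling free variables of two different windows and (H2) no insulator coupled to any free variable. -/
def InsulatedWindows {n : ℕ} (𝓢 : Set (Finset (Fin n))) (F : ℕ) : Prop :=
  ∃ p q : ℕ → ℕ,
    2 ≤ q 0 ∧ q F + 3 ≤ n ∧
    (∀ j < F, q j < p j ∧ p j + 1 < q (j + 1)) ∧
    (∀ j < F, ∀ j' < F, j ≠ j' → ∀ a ∈ ({p j, p j + 1} : Finset ℕ), ∀ b ∈ ({p j', p j' + 1} : Finset ℕ),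
        ¬ NCoupled 𝓢 a b) ∧
    (∀ i ≤ F, ∀ j < F, ∀ b ∈ ({p j, p j + 1} : Finset ℕ), ¬ NCoupled 𝓢 (q i) b)

/-- **(NP-Γ) `RingHardSparse3`** (OPEN; paper proof ROUND-34P2 §4.4): strategies whose monomial supports admit
`C·log₂ n` insulated windows lose a `≥ n^{−e}` fraction of the odd class.  No degree hypothesis. -/
def RingHardSparse3 : Prop :=
  open scoped Classical in
  ∃ e C n₀ : ℕ, ∀ n ≥ n₀, ∀ 𝓢 : Set (Finset (Fin n)), InsulatedWindows 𝓢 (C * Nat.log 2 n) →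
    ∀ P : Fin n → Smolensky.CubeFn (ZMod 3) n,
      (∀ i, P i ∈ Submodule.span (ZMod 3) (Smolensky.mono (ZMod 3) '' 𝓢)) →
      ((univ.filter fun x : Fin n → Bool =>
          OddZeros x ∧ RingHLF.Rel x (fun i => decide (P i x = 1))).card : ℝ) ≤
        (1 - 1 / (n : ℝ) ^ e) * (2 : ℝ) ^ (n - 1)

/-- **`RingHardFewCouplings3`** (OPEN; corollary shape of `RingHardSparse3` + a greedy window selection): at most
`n² / (C (log₂ n)^3)` coupled pairs of positions suffice (e.g. every output an arbitrary function of its own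
`≤ √n / (C (log₂ n)^2)` inputs, or every output with `s` monomials of degree `d`, `n·s·d² ≤ n²/(C (log₂ n)^3)`). -/
def RingHardFewCouplings3 : Prop :=
  open scoped Classical in
  ∃ e C n₀ : ℕ, ∀ n ≥ n₀, ∀ 𝓢 : Finset (Finset (Fin n)),
    (((univ : Finset (Fin n × Fin n)).filter fun ab => ab.1 < ab.2 ∧ NCoupled (↑𝓢 : Set (Finset (Fin n))) ab.1 ab.2).card
        * (C * Nat.log 2 n ^ 3) ≤ n ^ 2) →
    ∀ P : Fin n → Smolensky.CubeFn (ZMod 3) n,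
      (∀ i, P i ∈ Submodule.span (ZMod 3) (Smolensky.mono (ZMod 3) '' (↑𝓢 : Set (Finset (Fin n))))) →
      ((univ.filter fun x : Fin n → Bool =>
          OddZeros x ∧ RingHLF.Rel x (fun i => decide (P i x = 1))).card : ℝ) ≤
        (1 - 1 / (n : ℝ) ^ e) * (2 : ℝ) ^ (n - 1)

/-! ### The finite resonance lemma (PROVED) -/

/-- sign `1 − 2x ∈ ℤ/3` of a bit. -/
def sg (x : Bool) : ZMod 3 := if x then 2 else 1

/-- the bit as an element of `ℤ/3`. -/
def bt (x : Bool) : ZMod 3 := if x then 1 else 0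

/-- The `v`-slope of `cA·x_A + cB·x_B + cAB·x_A x_B` along the pair flip `(x_A, x_B) ↦ (¬x_A, ¬x_B)` started at
`(x_A, x_B)`: `sg x_A·cA + sg x_B·cB + cAB·(x_A·sg x_B + x_B·sg x_A + sg x_A·sg x_B)`. -/
def slope (cA cB cAB : ZMod 3) (xA xB : Bool) : ZMod 3 :=
  sg xA * cA + sg xB * cB + cAB * (bt xA * sg xB + bt xB * sg xA + sg xA * sg xB)

/-- `slope` IS the slope: `D(¬x_A, ¬x_B) − D(x_A, x_B)` for `D = cA x_A + cB x_B + cAB x_A x_B`. -/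
theorem slope_eq (cA cB cAB : ZMod 3) (xA xB : Bool) :
    slope cA cB cAB xA xB =
      (cA * bt (!xA) + cB * bt (!xB) + cAB * (bt (!xA) * bt (!xB))) - (cA * bt xA + cB * bt xB + cAB * (bt xA * bt xB)) := by
  revert cA cB cAB xA xB; decide

/-- **4-PATTERN RESONANCE LEMMA.**  For fixed coefficients `cA, cB, cAB`, a nonzero multiplier `m` and a nonzero label
letter `κ` (= `σ·λ·sg(u_p)`), the letter `m·slope + κ` vanishes for AT MOST TWO of the four sign patterns `(x_A, x_B)`.
(So the orbit average of `2^{[letter = 0]}` under the two insulator involutions is `≤ 3/2`.) -/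
theorem fourPattern_le_two (cA cB cAB m κ : ZMod 3) (hm : m ≠ 0) (hκ : κ ≠ 0) :
    ((univ : Finset (Bool × Bool)).filter fun xy => m * slope cA cB cAB xy.1 xy.2 + κ = 0).card ≤ 2 := by
  revert cA cB cAB m κ; decide

end Summit.QuantumAdvantage.AdviceFreeQNC0.NPGamma37
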